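import Literature.MathematicalPhysics.QuantumFieldTheory.Balaban1983to89.Node00.N24Glue

/-!
# NODE N24 · binder B2 — the glue's declared binders SHARPENED toward the Stage-5 datum: (0.20) asked only ALONG RUNS INSIDE THE
# INTERVAL, and the β-window in the datum's OWN β-family `D.βfun` through the dictionary field `FiniteEpsData.curries`

TRACK A (YM-PLAN §2d, node N24 of 28), seat `pub-ymgap-dag-n24-a` (-a KNIT-BY-NAME); companion of `Node00.N24Glue` (p408985 a5d92fddb9a5), a NEW
importing module (append-only growth; no landed declaration touched).  THEOREMS ONLY, def-free, sorry-free, standard axioms; the CONVENTIONS OF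
RECORD block of `Node00.Carriers` applies.  Both refinements IMPLY the ref-D READ-CARD whitelist binders of N24 (`hrg : ∀ P, (leavesP w P).rgFlow`,
`hβ : BetaBoundsInInterval w.C.toB12 γ₀ w.b w.βup`) by tree theorems, and are what a Stage-5 record can deliver: a forward-generated construction
([Balaban1987RG1] (0.17)–(0.20)) solves (0.20) as long as the positive root exists — i.e. along runs that stay in `]0, γ]` —, not necessarily on
every run; and the β-side seats (binder rows B3 ∕ B4, the (D1) ∕ (D4) ∕ NODE O chain) state their facts about `D.βfun : FlowStep.HBeta`
(`FlowStep.BetaLowerH ∕ BetaUpperH ∕ BetaContH ∕ BetaAFH`), which the datum's field `curries : DagBinding.CurriesHBeta D.C.toB12 D.βfun` turns into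
`BetaBoundsInInterval D.C.toB12 γ₀ b β⁺` (`DagBinding.betaBoundsInInterval_of_boxBounds`).
* `N24_at_world₃_alongRuns` — `N24_at_world₃` with the RG binder weakened to `∀ P, (w.C P).flow.InInterval w.γ P.K → (leavesP w P).rgFlow`.
* `N24_at_datum₃_of_boxBounds` — (B2) for the datum from the ten open children, `hrgI` on `D.C`, and the box bounds
  `FlowStep.BetaLowerH w.b γ₀ D.βfun` (UNPRINTED positive lower bound, census T09.F) ∕ `FlowStep.BetaUpperH w.βup γ₀ D.βfun` ([Balaban1987RG1] p. 264,
  proof deferred in print).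
HONEST FRAMING: kernel bookkeeping over tree theorems by name; N24 is a COMPOSITE — not a node discharge, no count moves; one finite four-torus
programme at fixed ε ([Balaban1989LargeFieldII] Thm 1 scope); NOT ℝ⁴ ∕ infinite volume ∕ OS ∕ mass gap ∕ Clay.
-/

noncomputable section

namespace Literature.MathematicalPhysics.QuantumFieldTheory.Balaban1983to89.Node00

open DagBinding T4Continuum

/-- **The N24 glue with (0.20) asked only along runs inside the interval**: as `N24_at_world₃`, but the RG binder is
`hrgI : ∀ P, (w.C P).flow.InInterval w.γ P.K → (leavesP w P).rgFlow` — (0.20) is consumed only under the interval hypothesis of (B) (the flow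
step (2.6) `DagBinding.flowIneq26_of_alongRun` is invoked after `intro hsc`), so the weaker binder suffices; proof = the four lines of
`DagBinding.endStatementBPrinted_of_nodesP_interval` with `hrgI P hsc` in place of `hrg P`. [cite: Balaban1989LargeFieldII, Thm 1 p.355 + p.391; Balaban1987RG1, (0.20) p.256; Balaban1988Convergent, (2.6) p.255 (bookkeeping over the pinned form)] -/
theorem N24_at_world₃_alongRuns (w : WorldP) (hw : IsWorldOfRecord₃ w) (hγ : 0 < w.γ) {γ₀ : ℝ} (hγ₀ : w.γ ≤ γ₀)
    (h03 : ∀ P : B12.RunParams, Dag.B6_main (leavesP w P)) (h05 : ∀ P : B12.RunParams, Dag.B8_main (leavesP w P))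
    (h06 : ∀ P : B12.RunParams, Dag.B9_main (leavesP w P)) (h07 : ∀ P : B12.RunParams, Dag.B11_main (leavesP w P))
    (h08 : ∀ P : B12.RunParams, Dag.B10_main (leavesP w P)) (h09 : ∀ P : B12.RunParams, Dag.B12_main (leavesP w P))
    (h10 : ∀ P : B12.RunParams, Dag.B13_main (leavesP w P)) (h11 : ∀ P : B12.RunParams, Dag.B14_main (leavesP w P))
    (h12 : ∀ P : B12.RunParams, Dag.B15_main (leavesP w P)) (h13 : ∀ P : B12.RunParams, Dag.B16_main (leavesP w P))
    (hrgI : ∀ P : B12.RunParams, (w.C P).flow.InInterval w.γ P.K → (leavesP w P).rgFlow)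
    (hβ : BetaBoundsInInterval w.C.toB12 γ₀ w.b w.βup) : B16.EndStatementBPrinted w.C := by
  refine endStatementBPrinted_of_worldsP w hγ fun P =>
    uvStability_of_nodes (leavesP w P) (N24_nodes_of_children₃ w hw h03 h05 h06 h07 h08 h09 h10 h11 h12 h13 P) ?_
  intro hsc
  obtain ⟨hlo, hhi⟩ := alongRun_of_inInterval w.C.toB12 hβ hγ₀ P hsc
  exact flowIneq26_of_alongRun (w.withConsts 0 0) P (hrgI P hsc) hhi hlo fun k hk => (hsc k hk).1

section DatumH

variable {F : T4Family} {N : ℕ} [NeZero N]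

/-- **N24 · (B2) FOR THE DATUM with the β-window IN THE DATUM'S OWN β-FAMILY and (0.20) along in-interval runs**: for
`D : FiniteEpsData F SU(N)` and a Stage-3 world of record `w` on its construction (`hC : w.C = D.C`), `0 < w.γ ≤ γ₀`, the ten open children by name,
`hrgI : ∀ P, (D.C P).flow.InInterval w.γ P.K → (D.C P).flow.SatisfiesRG P.K` and the box bounds `w.b ≤ D.βfun ≤ w.βup` on `]0, γ₀]^{k+1}`
(`FlowStep.BetaLowerH w.b γ₀ D.βfun` — the UNPRINTED positive lower bound, census T09.F; `FlowStep.BetaUpperH w.βup γ₀ D.βfun` — [Balaban1987RG1]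
p. 264, proof deferred in print) give `B16.EndStatementBPrinted D.C`; the whitelist binder `BetaBoundsInInterval` is DERIVED from the box bounds and the
datum's dictionary field `D.curries` (`DagBinding.betaBoundsInInterval_of_boxBounds`). [cite: Balaban1989LargeFieldII, Thm 1 p.355 + p.391; Balaban1987RG1, (1.22) p.264 and §5 p.298 (the history β-family; bookkeeping over the pinned form)] -/
theorem N24_at_datum₃_of_boxBounds (D : FiniteEpsData F (Matrix.specialUnitaryGroup (Fin N) ℂ))
    (w : WorldP) (hw : IsWorldOfRecord₃ w) (hC : w.C = D.C) (hγ : 0 < w.γ) {γ₀ : ℝ} (hγ₀ : w.γ ≤ γ₀)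
    (h03 : ∀ P : B12.RunParams, Dag.B6_main (leavesP w P)) (h05 : ∀ P : B12.RunParams, Dag.B8_main (leavesP w P))
    (h06 : ∀ P : B12.RunParams, Dag.B9_main (leavesP w P)) (h07 : ∀ P : B12.RunParams, Dag.B11_main (leavesP w P))
    (h08 : ∀ P : B12.RunParams, Dag.B10_main (leavesP w P)) (h09 : ∀ P : B12.RunParams, Dag.B12_main (leavesP w P))
    (h10 : ∀ P : B12.RunParams, Dag.B13_main (leavesP w P)) (h11 : ∀ P : B12.RunParams, Dag.B14_main (leavesP w P))
    (h12 : ∀ P : B12.RunParams, Dag.B15_main (leavesP w P)) (h13 : ∀ P : B12.RunParams, Dag.B16_main (leavesP w P))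
    (hrgI : ∀ P : B12.RunParams, (D.C P).flow.InInterval w.γ P.K → (D.C P).flow.SatisfiesRG P.K)
    (hlo : FlowStep.BetaLowerH w.b γ₀ D.βfun) (hhi : FlowStep.BetaUpperH w.βup γ₀ D.βfun) :
    B16.EndStatementBPrinted D.C := by
  have hβ : BetaBoundsInInterval w.C.toB12 γ₀ w.b w.βup := by
    rw [hC]; exact betaBoundsInInterval_of_boxBounds D.C.toB12 D.βfun D.curries hlo hhi
  have hrgI' : ∀ P : B12.RunParams, (w.C P).flow.InInterval w.γ P.K → (leavesP w P).rgFlow := by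
    show ∀ P : B12.RunParams, (w.C P).flow.InInterval w.γ P.K → (w.C P).flow.SatisfiesRG P.K
    rw [hC]; exact hrgI
  exact hC ▸ N24_at_world₃_alongRuns w hw hγ hγ₀ h03 h05 h06 h07 h08 h09 h10 h11 h12 h13 hrgI' hβ

end DatumH

end Literature.MathematicalPhysics.QuantumFieldTheory.Balaban1983to89.Node00

end
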